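import Mathlib
import HarnessLib
import Literature.Analysis.Fourier.TorusGridPoissonSummation
import Literature.Analysis.FunctionSpaces.FlatTorusProofs
import Literature.Analysis.FunctionSpaces.TorusScalarFourierSeries

/-!
# Riemann sums of a periodic function over the `N`-grid: the grid average equals the integral over a period cell up to the
# ALIASED Fourier coefficients (Poisson summation on `(N⁻¹ℤ/ℤ)^d`, lifted to `ℝ^d`)

Topic `Literature/Analysis/Fourier`; namespace `Literature.Analysis.Fourier`.  Companion of `TorusGridPoissonSummation` (the identity
`Σ_{j ∈ (ℤ/N)^d} f(j/N) = N^d Σ_{N ∣ k} f̂(k)` for `f ∈ C((ℝ/ℤ)^d)`), written for a `ℤ^d`-PERIODIC function `g` on the Euclidean space `ℝ^d`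
(`Literature.Analysis.FunctionSpaces.Torus.IsLatticePeriodic`, descent `Torus.descend` to the flat torus of `…FunctionSpaces.FlatTorus`):

* `descend_torusGridPoint` — the descended function at the grid point `j/N` is `g(j/N)`;
* `integral_eq_setIntegral_vadd_unitCube_lift` — `∫_{T^d} f = ∫_{c + [0,1)^d} f ∘ proj` for EVERY translate of the unit cube
  (`Torus.integral_eq_integral_lift` is the case `c = 0`; Haar invariance on `T^d` and on `ℝ^d`);
  `setIntegral_vadd_unitCube_eq_of_isLatticePeriodic` — hence `∫_{c + [0,1)^d} g = ∫_{[0,1)^d} g` for periodic `g`;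
* `mFourierCoeff_descend_zero` — `𝓕(descend g)(0) = ∫_{[0,1)^d} g`;
* **`sum_grid_eq_mul_tsum_mFourierCoeff_descend`** — `Σ_{j ∈ (ℤ/N)^d} g(j/N) = N^d · Σ_{N ∣ k} 𝓕(descend g)(k)` (continuous periodic `g` with
  summable coefficients) [cite: Boyd2001, §4.5 Theorem 19 (4.44)];
* **`norm_gridAvg_sub_setIntegral_unitCube_le`** — `‖N^{-d} Σ_j g(j/N) − ∫_{[0,1)^d} g‖ ≤ Σ_{k ≠ 0, N ∣ k} ‖𝓕(descend g)(k)‖`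
  [cite: Boyd2001, §4.5 Theorem 20 (4.47)] (J. P. Boyd, *Chebyshev and Fourier Spectral Methods*, 2nd ed., Dover 2001, pp. 142–144: the aliasing identity
  of trigonometric interpolation and "the error … is the sum of the absolute values of all the neglected coefficients", here at the zeroth coefficient);
* `summable_mFourierCoeff_descend_of_contDiff` — for SMOOTH periodic `g` the coefficients are absolutely summable
  (`Torus.summable_norm_mFourierCoeff_scalar`) [cite: Grafakos2014, §3.3.3], so the two statements above apply unconditionally
  (`sum_grid_eq_mul_tsum_mFourierCoeff_of_contDiff`, `norm_gridAvg_sub_setIntegral_unitCube_le_of_contDiff`).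

Used by the Hubbard `KLProgramme` (lane c4a-1, LAYER 2 of the tadpole representation): the loop sum over the Brillouin-zone grid `(2π/L)ℤ_L²` of a
smooth `2π`-periodic integrand equals `L²·(2π)⁻²∫_{zone}` plus aliasing controlled by the Fourier tail (…Fourier.TorusGridAliasingTail).
Everything is proved; no definitions.
-/

noncomputable section

open Complex Finset MeasureTheory UnitAddTorus
open scoped Pointwise
open Literature.Analysis.FunctionSpaces Literature.Analysis.FunctionSpaces.Torus

namespace Literature.Analysis.Fourier

variable {d : Type*} [Fintype d] [DecidableEq d]

/-! ## §1 Descent bookkeeping -/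

omit [Fintype d] [DecidableEq d] in
/-- The grid point `j/N` of the torus is the projection of the Euclidean point with coordinates `(j i).val / N`. [folklore] -/
private theorem proj_toLp_grid (N : ℕ) (j : d → ZMod N) :
    Torus.proj (WithLp.toLp 2 fun i => ((j i).val : ℝ) / N) = torusGridPoint N j := by
  rw [Torus.proj_toLp]; rfl

/-- **The descended function at a grid point**: `descend g (j/N) = g(j/N)` (functions on `T^d` = `1`-periodic functions on `ℝ^d`).
[cite: Grafakos2014, §3.1.1] -/
theorem descend_torusGridPoint (g : EuclideanSpace ℝ d → ℂ) (hg : Torus.IsLatticePeriodic g) (N : ℕ) (j : d → ZMod N) :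
    Torus.descend g hg (torusGridPoint N j) = g (WithLp.toLp 2 fun i => ((j i).val : ℝ) / N) := by
  have h := congrFun (Torus.lift_descend_holds g hg) (WithLp.toLp 2 fun i => ((j i).val : ℝ) / N)
  rwa [Torus.lift_apply, proj_toLp_grid] at h

/-- The descent of a continuous periodic function is continuous (functions on `T^d` = `1`-periodic functions on `ℝ^d`). [cite: Grafakos2014, §3.1.1] -/
theorem continuous_descend {F : Type*} [TopologicalSpace F] (g : EuclideanSpace ℝ d → F) (hg : Torus.IsLatticePeriodic g)
    (hc : Continuous g) : Continuous (Torus.descend g hg) := by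
  rw [← Torus.continuous_lift_iff, Torus.lift_descend_holds]
  exact hc

/-- The descent of a smooth periodic function is smooth (functions on `T^d` = `1`-periodic functions on `ℝ^d`). [cite: Grafakos2014, §3.1.1] -/
theorem isSmooth_descend {F : Type*} [NormedAddCommGroup F] [NormedSpace ℝ F] (g : EuclideanSpace ℝ d → F)
    (hg : Torus.IsLatticePeriodic g) (hs : ContDiff ℝ (⊤ : ℕ∞) g) : Torus.IsSmooth (Torus.descend g hg) := by
  unfold Torus.IsSmooth
  rw [Torus.lift_descend_holds]
  exact hs

/-! ## §2 The integral over ANY translate of the unit cube -/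

omit [DecidableEq d] in
/-- **`∫_{T^d} f = ∫_{c + [0,1)^d} (f ∘ proj)`** for every `c ∈ ℝ^d`: the torus integral is the integral of the lift over any translated period cell
(Haar invariance on `T^d`: `∫ f = ∫ f(· + proj c)`; then `Torus.integral_eq_integral_lift` and translation invariance of Lebesgue measure).
[cite: Grafakos2014, §3.1.1] -/
theorem integral_eq_setIntegral_vadd_unitCube_lift {F : Type*} [NormedAddCommGroup F] [NormedSpace ℝ F] (f : UnitAddTorus d → F)
    (c : EuclideanSpace ℝ d) : ∫ x, f x = ∫ y in c +ᵥ Torus.unitCube d, Torus.lift f y := by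
  -- Haar invariance on the torus
  have h1 : ∫ x, f x = ∫ x, f (x + Torus.proj c) := (integral_add_right_eq_self f (Torus.proj c)).symm
  -- the unit cube for the translated function
  have h2 : ∫ x, f (x + Torus.proj c) = ∫ y in Torus.unitCube d, Torus.lift f (y + c) := by
    rw [Torus.integral_eq_integral_lift_holds]
    refine setIntegral_congr_fun Torus.measurableSet_unitCube fun y _ => ?_
    simp only [Torus.lift_apply, Torus.proj_add]
  -- translation invariance of Lebesgue measure on `ℝ^d`
  have h3 : ∫ y in Torus.unitCube d, Torus.lift f (y + c) = ∫ y in c +ᵥ Torus.unitCube d, Torus.lift f y := by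
    have hmp : MeasurePreserving (fun y : EuclideanSpace ℝ d => y + c) volume volume := measurePreserving_add_right volume c
    have hemb : MeasurableEmbedding fun y : EuclideanSpace ℝ d => y + c := (MeasurableEquiv.addRight c).measurableEmbedding
    have hpre : (fun y : EuclideanSpace ℝ d => y + c) ⁻¹' (c +ᵥ Torus.unitCube d) = Torus.unitCube d := by
      ext y
      rw [Set.mem_preimage, Set.mem_vadd_set_iff_neg_vadd_mem, vadd_eq_add, show -c + (y + c) = y by abel]
    calc ∫ y in Torus.unitCube d, Torus.lift f (y + c)
        = ∫ y in (fun y : EuclideanSpace ℝ d => y + c) ⁻¹' (c +ᵥ Torus.unitCube d), Torus.lift f (y + c) := by rw [hpre]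
      _ = ∫ y in c +ᵥ Torus.unitCube d, Torus.lift f y := hmp.setIntegral_preimage_emb hemb _ _
  rw [h1, h2, h3]

/-- **A periodic function has the same integral over every translate of the unit cube**: `∫_{c + [0,1)^d} g = ∫_{[0,1)^d} g`.
[cite: Grafakos2014, §3.1.1] -/
theorem setIntegral_vadd_unitCube_eq_of_isLatticePeriodic {F : Type*} [NormedAddCommGroup F] [NormedSpace ℝ F]
    (g : EuclideanSpace ℝ d → F) (hg : Torus.IsLatticePeriodic g) (c : EuclideanSpace ℝ d) :
    ∫ y in c +ᵥ Torus.unitCube d, g y = ∫ y in Torus.unitCube d, g y := by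
  have h1 := integral_eq_setIntegral_vadd_unitCube_lift (Torus.descend g hg) c
  have h0 := integral_eq_setIntegral_vadd_unitCube_lift (Torus.descend g hg) 0
  rw [Torus.lift_descend_holds] at h1 h0
  rw [zero_vadd] at h0
  rw [← h1, h0]

/-! ## §3 The zeroth coefficient and the Riemann sum -/

/-- `𝓕(descend g)(0) = ∫_{[0,1)^d} g` — the zeroth Fourier coefficient is the integral over the fundamental cube. [cite: Grafakos2014, §3.1.1] -/
theorem mFourierCoeff_descend_zero (g : EuclideanSpace ℝ d → ℂ) (hg : Torus.IsLatticePeriodic g) :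
    mFourierCoeff (Torus.descend g hg) 0 = ∫ y in Torus.unitCube d, g y := by
  rw [Torus.mFourierCoeff_eq_integral_volume]
  have h : (fun x : UnitAddTorus d => mFourier (-0) x • Torus.descend g hg x) = Torus.descend g hg := by
    funext x
    simp [mFourier_zero]
  rw [h, Torus.integral_eq_integral_lift_holds, Torus.lift_descend_holds]

/-- **The Riemann sum over the `N`-grid of a continuous periodic function with summable Fourier coefficients**:
`Σ_{j ∈ (ℤ/N)^d} g(j/N) = N^d · Σ_{k : N ∣ k} 𝓕(descend g)(k)`. [cite: Boyd2001, §4.5 Theorem 19 (4.44)] -/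
theorem sum_grid_eq_mul_tsum_mFourierCoeff_descend (N : ℕ) [NeZero N] (g : EuclideanSpace ℝ d → ℂ) (hg : Torus.IsLatticePeriodic g)
    (hc : Continuous g) (hs : Summable (mFourierCoeff (Torus.descend g hg))) :
    ∑ j : d → ZMod N, g (WithLp.toLp 2 fun i => ((j i).val : ℝ) / N) =
      (N : ℂ) ^ Fintype.card d * ∑' k : d → ℤ, (if ∀ i, (N : ℤ) ∣ k i then mFourierCoeff (Torus.descend g hg) k else 0) := by
  have h := sum_torusGrid_eq_tsum_mFourierCoeff N (⟨Torus.descend g hg, continuous_descend g hg hc⟩ : C(UnitAddTorus d, ℂ)) hs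
  simp only [ContinuousMap.coe_mk, descend_torusGridPoint] at h
  exact h

/-- **The aliasing error of the Riemann sum**: `‖N^{-d} Σ_j g(j/N) − ∫_{[0,1)^d} g‖ ≤ Σ_{k ≠ 0, N ∣ k} ‖𝓕(descend g)(k)‖`.
[cite: Boyd2001, §4.5 Theorem 20 (4.47)] -/
theorem norm_gridAvg_sub_setIntegral_unitCube_le (N : ℕ) [NeZero N] (g : EuclideanSpace ℝ d → ℂ) (hg : Torus.IsLatticePeriodic g)
    (hc : Continuous g) (hs : Summable (mFourierCoeff (Torus.descend g hg))) :
    ‖((N : ℂ) ^ Fintype.card d)⁻¹ * ∑ j : d → ZMod N, g (WithLp.toLp 2 fun i => ((j i).val : ℝ) / N) - ∫ y in Torus.unitCube d, g y‖ ≤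
      ∑' k : d → ℤ, (if k ≠ 0 ∧ ∀ i, (N : ℤ) ∣ k i then ‖mFourierCoeff (Torus.descend g hg) k‖ else 0) := by
  have h := norm_torusGridAvg_sub_mFourierCoeff_zero_le N (⟨Torus.descend g hg, continuous_descend g hg hc⟩ : C(UnitAddTorus d, ℂ)) hs
  simp only [ContinuousMap.coe_mk, descend_torusGridPoint, mFourierCoeff_descend_zero] at h
  exact h

/-! ## §4 Smooth periodic functions -/

/-- For a SMOOTH periodic `g` the Fourier coefficients of the descent are absolutely summable. [cite: Grafakos2014, §3.3.3] -/
theorem summable_mFourierCoeff_descend_of_contDiff (g : EuclideanSpace ℝ d → ℂ) (hg : Torus.IsLatticePeriodic g)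
    (hs : ContDiff ℝ (⊤ : ℕ∞) g) : Summable (mFourierCoeff (Torus.descend g hg)) :=
  .of_norm (Torus.summable_norm_mFourierCoeff_scalar (isSmooth_descend g hg hs))

/-- **The Riemann sum of a smooth periodic function** (`sum_grid_eq_mul_tsum_mFourierCoeff_descend`, summability discharged).
[cite: Boyd2001, §4.5 Theorem 19 (4.44)] -/
theorem sum_grid_eq_mul_tsum_mFourierCoeff_of_contDiff (N : ℕ) [NeZero N] (g : EuclideanSpace ℝ d → ℂ) (hg : Torus.IsLatticePeriodic g)
    (hs : ContDiff ℝ (⊤ : ℕ∞) g) :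
    ∑ j : d → ZMod N, g (WithLp.toLp 2 fun i => ((j i).val : ℝ) / N) =
      (N : ℂ) ^ Fintype.card d * ∑' k : d → ℤ, (if ∀ i, (N : ℤ) ∣ k i then mFourierCoeff (Torus.descend g hg) k else 0) :=
  sum_grid_eq_mul_tsum_mFourierCoeff_descend N g hg hs.continuous (summable_mFourierCoeff_descend_of_contDiff g hg hs)

/-- **The aliasing error for a smooth periodic function** (`norm_gridAvg_sub_setIntegral_unitCube_le`, summability discharged).
[cite: Boyd2001, §4.5 Theorem 20 (4.47)] -/
theorem norm_gridAvg_sub_setIntegral_unitCube_le_of_contDiff (N : ℕ) [NeZero N] (g : EuclideanSpace ℝ d → ℂ)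
    (hg : Torus.IsLatticePeriodic g) (hs : ContDiff ℝ (⊤ : ℕ∞) g) :
    ‖((N : ℂ) ^ Fintype.card d)⁻¹ * ∑ j : d → ZMod N, g (WithLp.toLp 2 fun i => ((j i).val : ℝ) / N) - ∫ y in Torus.unitCube d, g y‖ ≤
      ∑' k : d → ℤ, (if k ≠ 0 ∧ ∀ i, (N : ℤ) ∣ k i then ‖mFourierCoeff (Torus.descend g hg) k‖ else 0) :=
  norm_gridAvg_sub_setIntegral_unitCube_le N g hg hs.continuous (summable_mFourierCoeff_descend_of_contDiff g hg hs)

end Literature.Analysis.Fourier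

end
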